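import Summits.QuantumAdvantage.QuantumAdvantage.Theorems.PurityDialLawK

/-! # PurityDialLawL — part 12/13 (mechanical split for landing of `PurityDialLaw`; content verbatim; scopes re-opened with their variables) -/

set_option linter.dupNamespace false
noncomputable section

namespace Summit.QuantumAdvantage.QuantumAdvantage.Theorems.PurityDialLaw
open Classical Finset Summit.QuantumAdvantage.AdviceFreeQNC0
open Literature.Computability.MetaComplexity Literature.Computability.MetaComplexity.Smolensky
open Literature.Computability.Complexity (parityFn)

section PolyTests

variable {m : ℕ}

/-- the analytic input in rate form: `Q·(2μ)^m ≤ 2^m` once `0 ≤ μ ≤ 1 − 1/R`, `Q ≤ 2^L` and `m ≥ R·L`. -/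
theorem mu_pow_le_of_log (μ : ℝ) (R m Q L : ℕ) (hμ0 : 0 ≤ μ) (hR : 1 ≤ R) (hμ : μ ≤ 1 - 1 / R)
    (hQ : Q ≤ 2 ^ L) (hm : R * L ≤ m) : (Q : ℝ) * (2 * μ) ^ m ≤ 2 ^ m := by
  have hRpos : (0 : ℝ) < R := by exact_mod_cast hR
  set y : ℝ := 1 / (R : ℝ) with hy
  have hy0 : 0 ≤ y := by positivity
  have h1 : (2 * μ) ^ m ≤ (2 * (1 - y)) ^ m := pow_le_pow_left₀ (by positivity) (by linarith) m
  have h2 : (1 - y) ^ m ≤ Real.exp (-y) ^ m := pow_le_pow_left₀ (by linarith) (Real.one_sub_le_exp_neg y) m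
  have h3 : Real.exp (-y) ^ m = Real.exp (-(m * y)) := by rw [← Real.exp_nat_mul]; ring_nf
  have hmy : (L : ℝ) ≤ m * y := by
    have : ((R * L : ℕ) : ℝ) ≤ m := by exact_mod_cast hm
    push_cast at this
    rw [hy, show (m : ℝ) * (1 / (R : ℝ)) = m / R by ring, le_div_iff₀ hRpos]
    linarith
  have hQL : (Q : ℝ) ≤ 2 ^ L := by exact_mod_cast hQ
  have hexpL : (2 : ℝ) ^ L ≤ Real.exp L := by
    rw [show (L : ℝ) = L * 1 by ring, Real.exp_nat_mul]
    exact pow_le_pow_left₀ (by norm_num) (by have := Real.add_one_le_exp 1; linarith) L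
  have hexp : (Q : ℝ) ≤ Real.exp (m * y) := hQL.trans (hexpL.trans (Real.exp_le_exp.2 hmy))
  have hpos : (0 : ℝ) < Real.exp (m * y) := Real.exp_pos _
  calc (Q : ℝ) * (2 * μ) ^ m
      ≤ Q * (2 * (1 - y)) ^ m := by gcongr
    _ = 2 ^ m * (Q * (1 - y) ^ m) := by rw [mul_pow]; ring
    _ ≤ 2 ^ m * (Q * Real.exp (-(m * y))) := by rw [← h3]; gcongr
    _ ≤ 2 ^ m * 1 := by
        gcongr
        rw [Real.exp_neg, ← div_eq_mul_inv, div_le_one hpos]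
        exact hexp
    _ = 2 ^ m := mul_one _

/-- **a function of `K` polynomial TESTS `mod q`**: `u ↦ φ(T_1(u), …, T_K(u))` for arbitrary test polynomials
`T_j : {0,1}^m → ℤ/q` (their degree is a hypothesis of the theorems, `T_j ∈ TwoModuli.degLE (ZMod q) (Fin m) e`);
`e = 1` contains the functions of `K` linear forms (`ofForms_eq_ofTests`, `linForms_mem_degLE`). -/
def ofTests {q K : ℕ} (T : Fin K → (Fin m → Bool) → ZMod q) (φ : (Fin K → ZMod q) → Bool) : (Fin m → Bool) → Bool :=
  fun u => φ (fun j => T j u)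

/-- Purity-dial helper `ofForms_eq_ofTests` (lens-4 g6 PurityDialLaw v12 twin; see the enclosing section docstring). -/
theorem ofForms_eq_ofTests {q K : ℕ} (lam : Fin K → Fin m → ZMod q) (φ : (Fin K → ZMod q) → Bool) :
    ofForms lam φ = ofTests (fun j u => linForms lam u j) φ := rfl

/-- linear forms are tests of degree `≤ 1`. -/
theorem linForms_mem_degLE {q K : ℕ} (lam : Fin K → Fin m → ZMod q) (j : Fin K) :
    (fun u => linForms lam u j) ∈ TwoModuli.degLE (ZMod q) (Fin m) 1 := by
  have h : (fun u => linForms lam u j) = ∑ i : Fin m, lam j i • TwoModuli.cubeMono (ZMod q) ({i} : Finset (Fin m)) := by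
    funext u
    simp only [linForms, Finset.sum_apply, Pi.smul_apply, smul_eq_mul, TwoModuli.cubeMono, Finset.prod_singleton,
      mul_ite, mul_one, mul_zero]
  rw [h]
  exact Submodule.sum_mem _ fun i _ =>
    Submodule.smul_mem _ _ (TwoModuli.cubeMono_mem_degLE (by rw [Finset.card_singleton]))

/-- **THE BIAS OF A FUNCTION OF `K` DEGREE-`e` TESTS (PROVED, from the tree's Green–Roy–Straubing / Bourgain file):**
for `q` odd, `|#even f − #odd f| ≤ q^K·(2μ_e)^m` with `μ_e = grsMu q 2 e < 1`
(`TwoModuli.norm_sum_testFun_mul_pow_card_le` with the parity twist `m = 2`, `a = 1`). -/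
theorem abs_sub_parts_ofTests_le (q : ℕ) [NeZero q] (hq2 : q.Coprime 2) {K e : ℕ}
    (T : Fin K → (Fin m → Bool) → ZMod q) (hT : ∀ j, T j ∈ TwoModuli.degLE (ZMod q) (Fin m) e)
    (φ : (Fin K → ZMod q) → Bool) :
    |((evenPart (ofTests T φ)).card : ℝ) - (oddPart (ofTests T φ)).card| ≤
      (q : ℝ) ^ K * (2 * TwoModuli.grsMu q 2 e) ^ m := by
  set sgn : (Fin m → Bool) → ℂ := fun u =>
    (ZMod.stdAddChar (1 : ZMod 2) : ℂ) ^ (univ.filter fun i => u i = true).card with hsgn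
  set G : (Fin K → ZMod q) → ℂ := fun v => if φ v = true then 1 else 0 with hGdef
  have hEO : (((evenPart (ofTests T φ)).card : ℝ) : ℂ) - (((oddPart (ofTests T φ)).card : ℝ) : ℂ) =
      ∑ u : Fin m → Bool, G (fun j => T j u) * sgn u := by
    have hE : (((evenPart (ofTests T φ)).card : ℝ) : ℂ) =
        ∑ u : Fin m → Bool, (if ofTests T φ u = true ∧ parityFn m u = false then (1 : ℂ) else 0) := by
      unfold evenPart; rw [Complex.ofReal_natCast, natCast_card_filter]
    have hO : (((oddPart (ofTests T φ)).card : ℝ) : ℂ) =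
        ∑ u : Fin m → Bool, (if ofTests T φ u = true ∧ parityFn m u = true then (1 : ℂ) else 0) := by
      unfold oddPart; rw [Complex.ofReal_natCast, natCast_card_filter]
    rw [hE, hO, ← sum_sub_distrib]
    refine sum_congr rfl fun u _ => ?_
    rw [hsgn, hGdef]; dsimp only; rw [stdAddChar_pow_wt]
    unfold ofTests
    cases φ (fun j => T j u) <;> cases parityFn m u <;> simp
  have hGn : ∀ v, ‖G v‖ ≤ 1 := by
    intro v; rw [hGdef]; dsimp only
    by_cases h : φ v = true
    · rw [if_pos h, norm_one]
    · rw [if_neg h, norm_zero]; exact zero_le_one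
  have h := TwoModuli.norm_sum_testFun_mul_pow_card_le (m := 2) (q := q) hq2.symm hT G hGn
    (a := (1 : ZMod 2)) (by decide)
  rw [Fintype.card_fin] at h
  have hnorm : ‖(((evenPart (ofTests T φ)).card : ℝ) : ℂ) - (((oddPart (ofTests T φ)).card : ℝ) : ℂ)‖ ≤
      (q : ℝ) ^ K * (2 * TwoModuli.grsMu q 2 e) ^ m := by rw [hEO]; exact h
  rw [← Complex.ofReal_sub, Complex.norm_real, Real.norm_eq_abs] at hnorm
  exact hnorm

/-- `1/(2q²(q2^q)^{e−1}) ≤ 1 − μ_e`: the GRS rate (second claim of their Thm 1.1 with `μ₁ = cos(π/2q) ≤ 1 − 1/2q²`). -/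
theorem grsMu_two_le (q : ℕ) [NeZero q] {e : ℕ} (he : 1 ≤ e) :
    TwoModuli.grsMu q 2 e ≤ 1 - 1 / ((2 * q ^ 2 * (q * 2 ^ q) ^ (e - 1) : ℕ) : ℝ) := by
  have hq1 : 1 ≤ q := Nat.pos_of_ne_zero (NeZero.ne q)
  have hqR : (1 : ℝ) ≤ q := by exact_mod_cast hq1
  have h2q : 2 ≤ 2 * q := by omega
  have hπ := Real.pi_pos
  -- `1 − μ₁ ≥ 1/(2q²)`
  have hx : |Real.pi / (2 * q)| ≤ Real.pi := by
    rw [abs_of_nonneg (by positivity)]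
    rw [div_le_iff₀ (by positivity)]; nlinarith
  have hcos_le : Real.cos (Real.pi / (2 * q)) ≤ 1 - 1 / (2 * (q : ℝ) ^ 2) := by
    refine (Real.cos_le_one_sub_mul_cos_sq hx).trans (le_of_eq ?_)
    field_simp
  have hμ1 : 1 / (2 * (q : ℝ) ^ 2) ≤ 1 - TwoModuli.grsMu q 2 1 := by
    rw [TwoModuli.grsMu_one, Nat.cast_ofNat]; linarith
  have hB := TwoModuli.one_sub_grsMu_one_div_le (q := q) (m := 2) h2q he
  have hD : (0 : ℝ) < ((q : ℝ) * 2 ^ q) ^ (e - 1) := by positivity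
  have hA : 1 / (2 * (q : ℝ) ^ 2) / ((q : ℝ) * 2 ^ q) ^ (e - 1) ≤ 1 - TwoModuli.grsMu q 2 e :=
    le_trans (div_le_div_of_nonneg_right hμ1 hD.le) hB
  have hRe : (1 : ℝ) / ((2 * q ^ 2 * (q * 2 ^ q) ^ (e - 1) : ℕ) : ℝ) =
      1 / (2 * (q : ℝ) ^ 2) / ((q : ℝ) * 2 ^ q) ^ (e - 1) := by
    push_cast; rw [div_div]
  rw [hRe]; linarith

/-- **FUNCTIONS OF FEW POLYNOMIAL TESTS OBEY A LINEAR LAW (PROVED; the POLYNOMIAL-RANK class).**  For `q` odd, `e ≥ 1`,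
tests `T_1, …, T_K : {0,1}^m → ℤ/q` of degree `≤ e` and any combiner `φ`: if `f = φ(T_1, …, T_K)` has `𝔽_p`-degree `≤ d`
(`p` any prime) and `m ≥ 2q²(q·2^q)^{e−1}·(d + 1 + K(log₂ q + 1))`, then `f` is `3`-balanced — bias
`≤ q^K (2μ_e)^m` (Green–Roy–Straubing / Bourgain, the tree's `LowDegreeTwoModuliExpSums`) against DLSZ `#f ≥ 2^{m−d}`.  For
fixed `(q, e)` the threshold is LINEAR in `d` and `K`; `e = 1` is `relBal_three_ofForms_mod`. -/
theorem relBal_three_ofTests (p : ℕ) [hp : Fact p.Prime] {q : ℕ} [NeZero q] (hq2 : q.Coprime 2) {K d e : ℕ}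
    (he : 1 ≤ e) (T : Fin K → (Fin m → Bool) → ZMod q) (hT : ∀ j, T j ∈ TwoModuli.degLE (ZMod q) (Fin m) e)
    (φ : (Fin K → ZMod q) → Bool) (hf : HasDegF p (ofTests T φ) d)
    (hm : 2 * q ^ 2 * (q * 2 ^ q) ^ (e - 1) * (d + 1 + K * (Nat.log 2 q + 1)) ≤ m) : RelBal 3 (ofTests T φ) := by
  set f := ofTests T φ with hfdef
  have hq1 : 1 ≤ q := Nat.pos_of_ne_zero (NeZero.ne q)
  have hR1 : 1 ≤ 2 * q ^ 2 * (q * 2 ^ q) ^ (e - 1) := by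
    have : 1 ≤ (q * 2 ^ q) ^ (e - 1) := Nat.one_le_pow _ _ (by positivity)
    nlinarith
  have hdm : d ≤ m := by
    have h1 : d + 1 + K * (Nat.log 2 q + 1) ≤ m := le_trans (Nat.le_mul_of_pos_left _ hR1) hm
    omega
  set P : CubeFn (ZMod p) m := fun x => if f x = true then (1 : ZMod p) else 0 with hPdef
  have hP : P ∈ lowDeg (ZMod p) m d := hf
  set a := (oddPart f).card with ha
  set b := (evenPart f).card with hb
  by_cases hP0 : P = 0
  · have hzero : ∀ z, f z = false := by
      intro z; have hz := congrFun hP0 z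
      simp only [hPdef, Pi.zero_apply] at hz
      cases hfz : f z
      · rfl
      · rw [hfz, if_pos rfl] at hz; exact absurd hz one_ne_zero
    exact relBal_of_forall_false hzero
  have hsupp : 2 ^ (m - d) ≤ a + b := by
    have h := two_pow_le_card_support hP hP0
    rw [← card_level_eq f]
    refine h.trans (le_of_eq (congrArg Finset.card (Finset.filter_congr fun x _ => ?_)))
    simp only [hPdef]
    cases f x <;> simp
  have hbias := abs_sub_parts_ofTests_le q hq2 T hT φ
  rw [← hfdef, ← ha, ← hb] at hbias
  have hQ : 2 ^ (d + 1) * q ^ K ≤ 2 ^ (d + 1 + K * (Nat.log 2 q + 1)) := by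
    rw [pow_add 2 (d + 1), mul_comm K, pow_mul]
    exact Nat.mul_le_mul_left _ (Nat.pow_le_pow_left (Nat.lt_pow_succ_log_self (by norm_num) q).le K)
  have hμ0 : 0 ≤ TwoModuli.grsMu q 2 e := TwoModuli.grsMu_nonneg (by omega) e
  have hcos := mu_pow_le_of_log (TwoModuli.grsMu q 2 e) (2 * q ^ 2 * (q * 2 ^ q) ^ (e - 1)) m
    (2 ^ (d + 1) * q ^ K) (d + 1 + K * (Nat.log 2 q + 1)) hμ0 hR1 (grsMu_two_le q he) hQ hm
  have hpow : (2 : ℝ) ^ (m - d) * 2 ^ d = 2 ^ m := by rw [← pow_add, Nat.sub_add_cancel hdm]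
  have hsmall : 2 * ((q : ℝ) ^ K * (2 * TwoModuli.grsMu q 2 e) ^ m) ≤ 2 ^ (m - d) := by
    have h2d : (0 : ℝ) < 2 ^ d := by positivity
    rw [← hpow] at hcos
    push_cast at hcos
    have : (2 * ((q : ℝ) ^ K * (2 * TwoModuli.grsMu q 2 e) ^ m)) * 2 ^ d ≤ 2 ^ (m - d) * 2 ^ d := by
      calc _ = 2 ^ (d + 1) * (q : ℝ) ^ K * (2 * TwoModuli.grsMu q 2 e) ^ m := by ring
        _ ≤ _ := hcos
    exact le_of_mul_le_mul_right this h2d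
  have hsuppR : ((2 ^ (m - d) : ℕ) : ℝ) ≤ ((a + b : ℕ) : ℝ) := by exact_mod_cast hsupp
  push_cast at hsuppR
  have hab := (abs_le.1 hbias)
  have h1 : (a : ℝ) ≤ 3 * b := by linarith [hab.1, hab.2]
  have h2 : (b : ℝ) ≤ 3 * a := by linarith [hab.1, hab.2]
  exact ⟨by exact_mod_cast h1, by exact_mod_cast h2⟩

/-- **tests modulo the degree prime carry their own degree (PROVED):** a function of `K` tests of degree `≤ e` over
`𝔽_p` has `𝔽_p`-degree `≤ K·e·(p−1)` — `[φ(T(u))] = Σ_{v : φ v} ∏_j (1 − (T_j(u) − v_j)^{p−1})` (Fermat). -/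
theorem hasDegF_ofTests (p : ℕ) [hp : Fact p.Prime] {K e : ℕ} (T : Fin K → (Fin m → Bool) → ZMod p)
    (hT : ∀ j, T j ∈ lowDeg (ZMod p) m e) (φ : (Fin K → ZMod p) → Bool) :
    HasDegF p (ofTests T φ) (K * (e * (p - 1))) := by
  have hp1 : 1 ≤ p - 1 := by have := hp.out.two_le; omega
  -- the Fermat indicator of one test value
  set ind : Fin K → (Fin K → ZMod p) → CubeFn (ZMod p) m := fun j v u => 1 - (T j u - v j) ^ (p - 1) with hind
  have hind_mem : ∀ j v, ind j v ∈ lowDeg (ZMod p) m (e * (p - 1)) := by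
    intro j v
    have hc : (fun _ : Fin m → Bool => v j) ∈ lowDeg (ZMod p) m e := by
      have : (fun _ : Fin m → Bool => v j) = v j • mono (ZMod p) (∅ : Finset (Fin m)) := by
        funext u; simp
      rw [this]; exact Submodule.smul_mem _ _ (mono_mem_lowDeg (by simp))
    have hdiff : (fun u => T j u - v j) ∈ lowDeg (ZMod p) m e := Submodule.sub_mem _ (hT j) hc
    have hpow : (fun u => (T j u - v j) ^ (p - 1)) ∈ lowDeg (ZMod p) m (e * (p - 1)) := by
      have h := prod_mem_lowDeg_card_mul (F := ZMod p) (Finset.range (p - 1)) (fun _ => fun u => T j u - v j)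
        (fun _ _ => hdiff)
      rw [Finset.prod_const, Finset.card_range, mul_comm] at h
      convert h using 1
      funext u; simp
    have hone : (fun _ : Fin m → Bool => (1 : ZMod p)) ∈ lowDeg (ZMod p) m (e * (p - 1)) := by
      have : (fun _ : Fin m → Bool => (1 : ZMod p)) = mono (ZMod p) (∅ : Finset (Fin m)) := by
        funext u; simp [mono_apply]
      rw [this]; exact mono_mem_lowDeg (by simp)
    have : ind j v = (fun _ : Fin m → Bool => (1 : ZMod p)) - fun u => (T j u - v j) ^ (p - 1) := by
      rw [hind]
      funext u; rfl
    rw [this]; exact Submodule.sub_mem _ hone hpow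
  have hind_val : ∀ j v u, ind j v u = if T j u = v j then 1 else 0 := by
    intro j v u
    rw [hind]; dsimp only
    by_cases h : T j u = v j
    · rw [if_pos h, h, sub_self, zero_pow (by omega), sub_zero]
    · rw [if_neg h, ZMod.pow_card_sub_one_eq_one (sub_ne_zero.2 h), sub_self]
  -- the product over the tests and the sum over the accepted value vectors
  have hprod_mem : ∀ v, (∏ j : Fin K, ind j v) ∈ lowDeg (ZMod p) m (K * (e * (p - 1))) := by
    intro v
    have h := prod_mem_lowDeg_card_mul (F := ZMod p) (univ : Finset (Fin K)) (fun j => ind j v)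
      (fun j _ => hind_mem j v)
    rwa [card_univ, Fintype.card_fin] at h
  have hprod_val : ∀ v u, (∏ j : Fin K, ind j v) u = if (fun j => T j u) = v then 1 else 0 := by
    intro v u
    rw [Finset.prod_apply]
    simp_rw [hind_val]
    rw [Finset.prod_boole]
    by_cases h : (fun j => T j u) = v
    · rw [if_pos h, if_pos]; intro j _; exact congrFun h j
    · rw [if_neg h, if_neg]; intro hall; exact h (funext fun j => hall j (mem_univ j))
  have heq : (fun u => if ofTests T φ u = true then (1 : ZMod p) else 0) =
      ∑ v ∈ univ.filter (fun v : Fin K → ZMod p => φ v = true), ∏ j : Fin K, ind j v := by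
    funext u
    rw [Finset.sum_apply]
    simp_rw [hprod_val]
    rw [Finset.sum_ite_eq (univ.filter fun v : Fin K → ZMod p => φ v = true) (fun j => T j u) (fun _ => (1 : ZMod p))]
    by_cases hφ : φ (fun j => T j u) = true
    · simp [mem_filter, ofTests, hφ]
    · simp [mem_filter, ofTests, hφ]
  unfold HasDegF
  rw [heq]
  exact Submodule.sum_mem _ fun v _ => hprod_mem v

/-- **UNCONDITIONAL (PROVED): every Boolean combination of `K` polynomial tests of degree `≤ e` over `𝔽_p` (`p` odd) on
`m ≥ 2p²(p·2^p)^{e−1}·(K e (p−1) + 1 + K(log₂ p + 1))` bits is `3`-balanced** — no degree hypothesis: the tests carry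
it (`hasDegF_ofTests`).  For fixed `(p, e)` this is every function of `K ≤ c_{p,e}·m` degree-`e` tests. -/
theorem relBal_three_ofTests_self (p : ℕ) [hp : Fact p.Prime] (hp2 : p ≠ 2) {K e : ℕ} (he : 1 ≤ e)
    (T : Fin K → (Fin m → Bool) → ZMod p) (hT : ∀ j, T j ∈ lowDeg (ZMod p) m e) (φ : (Fin K → ZMod p) → Bool)
    (hm : 2 * p ^ 2 * (p * 2 ^ p) ^ (e - 1) * (K * (e * (p - 1)) + 1 + K * (Nat.log 2 p + 1)) ≤ m) :
    RelBal 3 (ofTests T φ) := by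
  haveI : NeZero p := ⟨hp.out.ne_zero⟩
  have hT' : ∀ j, T j ∈ TwoModuli.degLE (ZMod p) (Fin m) e := fun j => by
    rw [← TwoModuli.smolensky_lowDeg_eq_degLE]; exact hT j
  exact relBal_three_ofTests p ((Nat.coprime_primes hp.out Nat.prime_two).2 hp2) he T hT' φ
    (hasDegF_ofTests p T hT φ) hm

end PolyTests

section IndecomposableNormalForm

/-- **NORMAL FORM (law level, v5): a minimal counterexample is INDECOMPOSABLE** — outside the tensor closure `BlockInv p`
(on top of mixed, polynomially windowed, asymmetric `normalForm_not_wtDetermined_law` and locally thick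
`normalForm_thick_law`). -/
theorem normalForm_not_blockInv_law (h : ¬ ∀ (p : ℕ) [Fact p.Prime], 5 ≤ p → ∃ B : ℕ, RelSmolLaw p 3 B) :
    ∃ (p : ℕ) (_ : Fact p.Prime), 5 ≤ p ∧ ∀ B A : ℕ, ∃ (m d : ℕ) (f : (Fin m → Bool) → Bool),
      A * (d + 1) ^ B ≤ m ∧ m < (d + 1) ^ 2 * 4 ^ (d + 1) ∧ HasDegF p f d ∧ ¬ RelBal 3 f ∧
      (oddPart f).Nonempty ∧ (evenPart f).Nonempty ∧ ¬ BlockInv p f := by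
  obtain ⟨p, hP, hp, hall⟩ := normalForm_of_not_relSmolPoly h
  refine ⟨p, hP, hp, fun B A => ?_⟩
  obtain ⟨A₀, hA₀⟩ := relSmolLaw_four_of_blockInv p
  obtain ⟨m, d, f, h1, h2, h3, h4, h5, h6⟩ := hall (max B 4) (max A A₀)
  have hd1 : 1 ≤ d + 1 := Nat.succ_le_succ (Nat.zero_le d)
  have hmB : A * (d + 1) ^ B ≤ m :=
    le_trans (Nat.mul_le_mul (le_max_left A A₀) (Nat.pow_le_pow_right hd1 (le_max_left B 4))) h1
  have hm4 : A₀ * (d + 1) ^ 4 ≤ m :=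
    le_trans (Nat.mul_le_mul (le_max_right A A₀) (Nat.pow_le_pow_right hd1 (le_max_right B 4))) h1
  exact ⟨m, d, f, hmB, h2, h3, h4, h5, h6, fun hI => h4 (hA₀ m d hm4 f hI h3)⟩

/-- **NORMAL FORM (law level, v7): … and SPARSE** — density `< 2^{-k}` whenever `(d+1)²·4^{k+1} ≤ m`
(`relBal_three_of_dense`). -/
theorem normalForm_sparse_law (h : ¬ ∀ (p : ℕ) [Fact p.Prime], 5 ≤ p → ∃ B : ℕ, RelSmolLaw p 3 B) :
    ∃ (p : ℕ) (_ : Fact p.Prime), 5 ≤ p ∧ ∀ B A : ℕ, ∃ (m d : ℕ) (f : (Fin m → Bool) → Bool),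
      A * (d + 1) ^ B ≤ m ∧ m < (d + 1) ^ 2 * 4 ^ (d + 1) ∧ HasDegF p f d ∧ ¬ RelBal 3 f ∧
      (oddPart f).Nonempty ∧ (evenPart f).Nonempty ∧ ¬ BlockInv p f ∧
      ∀ k : ℕ, (d + 1) ^ 2 * 4 ^ (k + 1) ≤ m → 2 ^ k * (univ.filter fun z => f z = true).card < 2 ^ m := by
  obtain ⟨p, hP, hp, hall⟩ := normalForm_not_blockInv_law h
  refine ⟨p, hP, hp, fun B A => ?_⟩
  obtain ⟨m, d, f, h1, h2, h3, h4, h5, h6, h7⟩ := hall B A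
  exact ⟨m, d, f, h1, h2, h3, h4, h5, h6, h7, fun k hk => card_lt_of_not_relBal (by omega) hk h3 h4⟩

/-- **NORMAL FORM (law level, v9): … and of HIGH `𝔽_p`-RANK** — the unbalanced level set is not a function of `K` linear
forms `mod p` for any `K` with `2p²(d + 1 + K(log₂ p + 1)) ≤ m` (`relBal_three_ofForms`). -/
theorem normalForm_highRank_law (h : ¬ ∀ (p : ℕ) [Fact p.Prime], 5 ≤ p → ∃ B : ℕ, RelSmolLaw p 3 B) :
    ∃ (p : ℕ) (_ : Fact p.Prime), 5 ≤ p ∧ ∀ B A : ℕ, ∃ (m d : ℕ) (f : (Fin m → Bool) → Bool),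
      A * (d + 1) ^ B ≤ m ∧ m < (d + 1) ^ 2 * 4 ^ (d + 1) ∧ HasDegF p f d ∧ ¬ RelBal 3 f ∧
      (oddPart f).Nonempty ∧ (evenPart f).Nonempty ∧ ¬ BlockInv p f ∧
      (∀ k : ℕ, (d + 1) ^ 2 * 4 ^ (k + 1) ≤ m → 2 ^ k * (univ.filter fun z => f z = true).card < 2 ^ m) ∧
      ∀ (K : ℕ) (lam : Fin K → Fin m → ZMod p) (φ : (Fin K → ZMod p) → Bool),
        2 * p ^ 2 * (d + 1 + K * (Nat.log 2 p + 1)) ≤ m → f ≠ ofForms lam φ := by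
  obtain ⟨p, hP, hp, hall⟩ := normalForm_sparse_law h
  refine ⟨p, hP, hp, fun B A => ?_⟩
  obtain ⟨m, d, f, h1, h2, h3, h4, h5, h6, h7, h8⟩ := hall B A
  refine ⟨m, d, f, h1, h2, h3, h4, h5, h6, h7, h8, fun K lam φ hK hf => h4 ?_⟩
  rw [hf] at h3 ⊢
  exact relBal_three_ofForms p (by omega) lam φ h3 hK

/-- law-level normal form, v11 (PROVED): the counterexample of `normalForm_highRank_law` is moreover not a function of `K`
polynomial tests of degree `≤ e` modulo any odd `q` whenever `2q²(q·2^q)^{e−1}(d + 1 + K(log₂ q + 1)) ≤ m` — HIGH POLYNOMIAL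
RANK at every bounded degree (`relBal_three_ofTests`). -/
theorem normalForm_highPolyRank_law (h : ¬ ∀ (p : ℕ) [Fact p.Prime], 5 ≤ p → ∃ B : ℕ, RelSmolLaw p 3 B) :
    ∃ (p : ℕ) (_ : Fact p.Prime), 5 ≤ p ∧ ∀ B A : ℕ, ∃ (m d : ℕ) (f : (Fin m → Bool) → Bool),
      A * (d + 1) ^ B ≤ m ∧ m < (d + 1) ^ 2 * 4 ^ (d + 1) ∧ HasDegF p f d ∧ ¬ RelBal 3 f ∧
      (oddPart f).Nonempty ∧ (evenPart f).Nonempty ∧ ¬ BlockInv p f ∧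
      (∀ k : ℕ, (d + 1) ^ 2 * 4 ^ (k + 1) ≤ m → 2 ^ k * (univ.filter fun z => f z = true).card < 2 ^ m) ∧
      (∀ (K : ℕ) (lam : Fin K → Fin m → ZMod p) (φ : (Fin K → ZMod p) → Bool),
        2 * p ^ 2 * (d + 1 + K * (Nat.log 2 p + 1)) ≤ m → f ≠ ofForms lam φ) ∧
      ∀ (q : ℕ) [NeZero q], q.Coprime 2 → ∀ (K e : ℕ), 1 ≤ e →
        ∀ (T : Fin K → (Fin m → Bool) → ZMod q), (∀ j, T j ∈ TwoModuli.degLE (ZMod q) (Fin m) e) →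
          ∀ (φ : (Fin K → ZMod q) → Bool),
            2 * q ^ 2 * (q * 2 ^ q) ^ (e - 1) * (d + 1 + K * (Nat.log 2 q + 1)) ≤ m → f ≠ ofTests T φ := by
  obtain ⟨p, hP, hp, hall⟩ := normalForm_highRank_law h
  refine ⟨p, hP, hp, fun B A => ?_⟩
  obtain ⟨m, d, f, h1, h2, h3, h4, h5, h6, h7, h8, h9⟩ := hall B A
  refine ⟨m, d, f, h1, h2, h3, h4, h5, h6, h7, h8, h9, fun q _ hq2 K e he T hT φ hm hf => h4 ?_⟩
  rw [hf] at h3 ⊢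
  exact relBal_three_ofTests p hq2 he T hT φ h3 hm

end IndecomposableNormalForm



/-! ### §21 RECORDS for the tree item 29180 `Theses.PolyFeatureDial.RelSmolOdd` -/


end Summit.QuantumAdvantage.QuantumAdvantage.Theorems.PurityDialLaw
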